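import Literature.NumberTheory.Automorphic.ClozelPurityProofs
import HarnessLib

/-!
# Hermitian symmetry of the archimedean parameter of a cuspidal representation
(crux `IrreducibilityBySelfDuality.RegularAdjointLiftCM`, item stmt-Langlands-13617, line
`nu-cubed-central-character`, registered stub `stub_hermitianSymmetry`)

The registered stub of the line, verbatim: for a cuspidal Borel–Jacquet datum `π` on `GL_n(𝔸_K)`
(`n ≥ 1`, any number field) with archimedean parameter `χ` there is ONE real `c` with
`χ(ῑ) = {-ā + c : a ∈ χ(ι)}` at every complex embedding `ι` — Clozel's purity lemma (Clozel 1990,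
Lemme 4.9) in its weight-free form on multisets, i.e. unitarity of `π_∞` up to a real central twist
read on the Harish-Chandra parameter (Knapp–Vogan 1995, Ch. IX §1).  It is PROVED in the Literature
file `ClozelPurityProofs` (`CuspidalAutomorphicRepData.archParameter_conjugate_eq_map_neg_conj_add`:
clean model, `A_G`-normalising complex twist, Petersson form pulled back, real Harish-Chandra shift,
`HasArchParameter.map_neg_conj_of_skewHermitian`); this file only re-exports it under the registered
name and signature, so that the skeleton's glue `purityGL3_of_hermitianSymmetry` closes `PurityGL3`.

## References

* L. Clozel, *Motifs et formes automorphes* (1990), Lemme 4.9. [Clozel1990]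
* A. W. Knapp, D. A. Vogan, *Cohomological Induction and Unitary Representations* (1995), Ch. IX §1.
  [KnappVogan1995]
-/

set_option linter.dupNamespace false

open scoped BigOperators Topology Classical
open Filter Set Function IsDedekindDomain NumberField
open Literature.NumberTheory.Automorphic

namespace Summit.Langlands.Langlands.Theorems.RegularAdjointLiftCM

/-- **Registered stub `stub_hermitianSymmetry`** (line `nu-cubed-central-character` of crux
stmt-Langlands-13617): the archimedean parameter of a cuspidal datum on `GL_n(𝔸_K)`, `n ≥ 1`, is
Hermitian-symmetric up to one real shift, `χ(ῑ) = {-ā + c : a ∈ χ(ι)}`.  Proof: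
`CuspidalAutomorphicRepData.archParameter_conjugate_eq_map_neg_conj_add` (Literature,
`ClozelPurityProofs`). [cite: Clozel1990, Lemme 4.9] [cite: KnappVogan1995, Ch. IX §1 (p. 597)] -/
theorem stub_hermitianSymmetry :
    ∀ (n : ℕ) [NeZero n] (K : Type) [Field K] [NumberField K] (hcpt : isCompact_glFiniteIntegralLevel n K)
      (π : CuspidalAutomorphicRepData n K hcpt) (χ : (K →+* ℂ) → Multiset ℂ), π.1.HasArchParameter χ →
        ∃ c : ℝ, ∀ ι : K →+* ℂ,
          χ (ComplexEmbedding.conjugate ι) = (χ ι).map fun a => -(starRingEnd ℂ a) + (c : ℂ) :=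
  fun _ _ _ _ _ _ π _ hχ => π.archParameter_conjugate_eq_map_neg_conj_add hχ

end Summit.Langlands.Langlands.Theorems.RegularAdjointLiftCM
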